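import Literature.NumberTheory.Automorphic.ShimuraCurveMapDegreeProofs
import Literature.NumberTheory.Automorphic.ShimuraCurveVolumeSplitCase
import Literature.NumberTheory.Automorphic.ShimuraCurveDegreeFormulaProofs
import Literature.NumberTheory.EllipticCurves.ModularSymbolsLattice
import Literature.NumberTheory.EllipticCurves.CuspFormTwist
import Literature.NumberTheory.EllipticCurves.HeckeOperatorsGamma0Proofs
import Literature.NumberTheory.EllipticCurves.NewformsHeckeProofs
import Literature.NumberTheory.EllipticCurves.ModularParametrizationDegreeHoldsProofs
import Literature.NumberTheory.EllipticCurves.ModularParametrizationDegreeProofs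
import Literature.NumberTheory.EllipticCurves.ModularSymbolsProofs
import HarnessLib

/-!
# Shimura-curve parametrisations in the split case `D = 1`: the automorphic half of
# `nonempty_shimuraParametrizationData` at level `(1, M)` from the Modularity theorem alone

Topic `NumberTheory/Automorphic`; theorems only (no definition, no named fact, no instance; D-0026).
A sibling of `ShimuraParametrizationExistenceProofs` / `ShimuraCurveMapDegreeProofs`, which reduce
the named fact `Literature.NumberTheory.Automorphic.nonempty_shimuraParametrizationData`
(Pasten 2024, §2 p. 12 and Prop. 5.1: Jacquet–Langlands parametrisations `X₀^D(M) → A_{D,M} ∼ E`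
exist) to its *automorphic half* — at `D = 1` for the modular curve, at `D > 1` a Jacquet–Langlands
eigenform with Néron periods (`nonempty_shimuraParametrizationData_of_one_and_eigenform`). This file
DISCHARGES THE `D = 1` HALF from the Modularity theorem `exists_isNewformOf` (Diamond–Shurman
Thm. 8.8.3; BCDT 2001 Thm. A) and theorems of the tree, for an ARBITRARY datum
`X : ShimuraCurveData 1 M` (any quaternion algebra `B/ℚ` with no ramified prime, any Eichler order
`O` of level `M`, any real splitting `ι`):

* `automorphicHalf_one_of_exists_isNewformOf` — the `D = 1` automorphic half;
* `nonempty_shimuraParametrizationData_of_exists_isNewformOf` — the fact from `exists_isNewformOf`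
  and the `D > 1` eigenform hypothesis `hJL` alone.

## The printed argument and its transport (Pasten §2 p. 12, §5.3 p. 17; Diamond–Shurman §5.2)

For `D = 1` Pasten's `φ_{1,N} = q_{1,N} ∘ j_N : X₀(N) → A_{1,N}` is the Eichler–Shimura optimal
quotient ("the Eichler–Shimura construction gives an optimal quotient `q_{1,N} : J₀(N) → A_{1,N}`
defined over `ℚ`, with `A_{1,N}` isogenous to `E`", §2 p. 12); analytically, on `ℂ/Λ_E`, it is
`Γ₀(N)τ ↦ c · 2πi ∫_{i∞}^τ f (mod Λ_E)` for the newform `f` of `E` and an integer `c ≠ 0` with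
`c Λ_f ⊆ Λ_E` — in the tree: `exists_isNewformOf` (modularity, the only named fact used),
`IsNewformOf.exists_maninConstant_ne_zero_holds` (Shimura's construction and Faltings, PROVED) and
`exists_modularDegree_holds` (the degree of `X₀(N) → ℂ/Λ`, PROVED). A datum `X` of level `(1, M)`
presents `X₀(M)(ℂ)` as `Γ₀^1(M)∖ℍ`, `Γ₀^1(M) = ι(O¹)`, and the file transports the classical
objects along the conjugation `Γ₀^1(M) = h Γ₀(M) h⁻¹`:

1. (`ShimuraCurveData.exists_conj_of_discr_one`) there is `h ∈ GL₂(ℝ)` with `det h > 0` and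
   `ι(O) = h {A ∈ M₂(ℤ) : M ∣ A₁₀} h⁻¹`: `B ≃ M₂(ℚ)` (tree `nonempty_algEquiv_matrix_of_discr_one`,
   Vignéras III Thm. 3.1), the Eichler order is `u (ℤ ℤ; Mℤ ℤ) u⁻¹` (tree
   `exists_units_forall_mem_iff_and_pos`, Vignéras II §2), the real splitting is `x ↦ g x g⁻¹`
   (Skolem–Noether, tree `exists_algHom_apply_eq_conj`), `h = g u` up to the sign matrix
   `J = diag(-1, 1)`; hence `h⁻¹ Γ₀^1(M) h = Γ₀(M)` (`conjAct_inv_smul_Gamma_eq_of_conj`) and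
   `ι(O(ℓ)) = h Δ(ℓ) h⁻¹`, `Δ(ℓ) = {det = ℓ, M ∣ A₁₀}` (`mem_heckeSet_iff_of_conj`).
2. (`exists_cuspForm_coe_eq_smul_slash`, `hasDerivAt_eichlerIntegral_smul`,
   `segmentIntegral_eq_and_hasPeriodsIn_of_conj`) `F = c · 2πi · (f ∣[2] h⁻¹) ∈ S₂(Γ₀^1(M))`
   (Mathlib `CuspForm.translate`) has the primitive `c · 2πi∫_{i∞}^{h⁻¹τ} f`
   (`d(h⁻¹τ)/dτ = det h⁻¹ / j(h⁻¹, τ)²`, Mathlib `UpperHalfPlane.hasStrictDerivAt_smul`), so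
   `∫_z^w F = c EI_f(h⁻¹w) − c EI_f(h⁻¹z)` and the periods of `F` on `Γ₀^1(M)` are `c · (periods of
   f on Γ₀(M)) ∈ c Λ_f ⊆ Λ` (tree `eichlerIntegral_gamma_smul_holds`).
3. (`heckeFun_eq_sum_of_conj`, `heckeFun_eq_mul_of_conj`) for `ℓ` prime, `ℓ ∤ M`, the Hecke
   operator `X.heckeFun ℓ` of the datum (sum of `F ∣[2] α` over `Γ₀^1(M)∖ι(O(ℓ))`) is the sum over
   the `ℓ + 1` conjugated classical representatives `h βᵢ h⁻¹`, `βᵢ ∈ {(1 j; 0 ℓ), diag(ℓ, 1)}`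
   (Diamond–Shurman Prop. 5.2.1; tree `existsUnique_mem_delta0_mul_heckeRep`, `coe_heckeT_gamma0`),
   so `T_ℓ F = c · 2πi · (T_ℓ f) ∣[2] h⁻¹ = a_ℓ(W) F` by `T_ℓ f = a_ℓ(f) f` (tree
   `IsNewform0.heckeT_eq_coeff_smul`, Diamond–Shurman Prop. 5.8.5) and `a_ℓ(f) = a_ℓ(W)`.
4. (`card_orbitFibre_eq_of_conj`, `finite_setOf_card_orbitFibre_ne_of_conj`)
   `Γ₀^1(M)τ ↦ Γ₀(M)(h⁻¹τ)` is a bijection `Γ₀^1(M)∖ℍ → Y₀(M)` matching the fibres of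
   `τ ↦ ∫_{τ₀}^τ F` with those of `τ' ↦ c EI_f(τ') − c EI_f(h⁻¹τ₀)`, so the cofinite fibre count
   `d` of `exists_modularDegree_holds` transports (translation by a constant of `ℂ/Λ`).
5. (`automorphicHalf_one_of_isNewformOf`, `automorphicHalf_one_of_exists_isNewformOf`,
   `nonempty_shimuraParametrizationData_of_exists_isNewformOf`) assembly, with `N = 1 · M = N_W`.

After this file the named fact is EXACTLY: the Modularity theorem (`exists_isNewformOf`, an
existing named fact of the tree) ∧ the `D > 1` statement `hJL` (Jacquet–Langlands 1970 Thm. 16.1 in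
classical form for `ι(O¹)`, Pasten §4.10, followed by Shimura's construction on `J₀^D(M)` and
Faltings, §4.11 and §2 — not stated in the tree in any form).

## References

* H. Pasten, *Shimura curves and the abc conjecture*, J. Number Theory 254 (2024) 214–335 =
  arXiv:1705.09251, §2 p. 12, §4.8 p. 15, §4.10–4.11 p. 16, Prop. 5.1 and §5.3 p. 17 (held
  arXiv text, read). [PastenShimura2024]
* F. Diamond, J. Shurman, *A first course in modular forms*, GTM 228 (2005), Prop. 5.2.1,
  Exercise 5.1.3, Prop. 5.8.5, Thm. 8.8.3. [DiamondShurman2005]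
* M.-F. Vignéras, *Arithmétique des algèbres de quaternions*, LNM 800 (1980), Ch. II §2,
  Ch. III Thm. 3.1, Ch. IV §1 exemple 4. [VignerasLNM800]
* H. Jacquet, R. P. Langlands, *Automorphic forms on GL(2)*, LNM 114 (1970), Thm. 16.1.
  [JacquetLanglands1970]

## Mathlib / tree search

Tree: `ShimuraCurveData.nonempty_algEquiv_matrix_of_discr_one`, `exists_mem_O_ι_eq_conj`,
`exists_conjAct_inv_smul_Gamma_eq_of_discr_one` (`ShimuraCurveVolumeSplitCase` — the conjugation,
re-proved here with the matrix-level description of `ι(O)` that the Hecke sets need),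
`segmentIntegral_eq_sub` (`ShimuraCurveDegreeFormulaProofs`), `coe_heckeT_gamma0`,
`existsUnique_mem_delta0_mul_heckeRep`, `intGL`, `heckeRep` (`HeckeOperatorsGamma0Proofs`),
`IsNewform0.heckeT_eq_coeff_smul` (`NewformsHeckeProofs`), `IsNewform0.ne_zero`
(`ModularSymbolsLattice`), `hasDerivAt_eichlerIntegral`, `eichlerIntegral_gamma_smul_holds`
(`ModularSymbolsProofs`), `exists_modularDegree_holds` (`ModularParametrizationDegreeProofs`),
`IsNewformOf.exists_maninConstant_ne_zero_holds` (`ModularParametrizationDegreeHoldsProofs`),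
`finite_setOf_card_orbitFibre_ne_iff` (`ShimuraParametrizationExistenceProofs`),
`nonempty_shimuraParametrizationData_of_one_and_eigenform` (`ShimuraCurveMapDegreeProofs`).
Mathlib: `CuspForm.translate`, `UpperHalfPlane.hasStrictDerivAt_smul`, `UpperHalfPlane.J`,
`ModularForm.smul_slash`, `finsum_eq_of_bijective`, `Quotient.map'`; tree `finset_sum_slash` (`CuspFormTwist`). No statement of 1–5 exists
in Mathlib or the tree (`lean search 'heckeFun_eq|of_discr_one|automorphicHalf_one'`).
-/

noncomputable section

open scoped MatrixGroups ModularForm Pointwise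
open UpperHalfPlane ConjAct Matrix.SpecialLinearGroup CongruenceSubgroup

namespace Literature.NumberTheory.Automorphic

open Literature.NumberTheory.EllipticCurves.ModularForms
  (intGL coe_intGL mapGL_eq_intGL intGL_mul intGL_inj heckeRep HeckeIdx Delta0 det_heckeRep
    det_heckeRep_ne_zero existsUnique_mem_delta0_mul_heckeRep exists_mem_delta0_one_iff heckeT
    coe_heckeT_gamma0 heckeRep_mem_delta0 eichlerIntegral periodLattice hasDerivAt_eichlerIntegral
    eichlerIntegral_gamma_smul_holds finset_sum_slash)

section SplitConj

variable {M : ℕ}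

/-- For the data of the split case (an isomorphism `e : B ≃ M₂(ℚ)` carrying `O` onto
`u O₀(M) u⁻¹` and a conjugator `g` of the real splitting `ι ∘ e⁻¹`, `h₀ = g u`): a real matrix is
`ι(x)` for some `x ∈ O` iff it is `h₀ A h₀⁻¹` for an integer matrix `A` with `M ∣ A₁₀`. [folklore] -/
theorem ShimuraCurveData.exists_mem_O_ι_eq_iff_of_data (X : ShimuraCurveData 1 M)
    (e : X.B ≃ₐ[ℚ] Matrix (Fin 2) (Fin 2) ℚ) (u : (Matrix (Fin 2) (Fin 2) ℚ)ˣ)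
    (hu : ∀ z : Matrix (Fin 2) (Fin 2) ℚ,
      z ∈ X.O.map ((e : X.B ≃+* Matrix (Fin 2) (Fin 2) ℚ).toAddEquiv.toIntLinearEquiv :
        X.B →ₗ[ℤ] Matrix (Fin 2) (Fin 2) ℚ) ↔
      (∀ i j, ∃ n : ℤ, (((u⁻¹ : (Matrix (Fin 2) (Fin 2) ℚ)ˣ) : Matrix (Fin 2) (Fin 2) ℚ) * z * u) i j = n) ∧
        ∃ n : ℤ, (((u⁻¹ : (Matrix (Fin 2) (Fin 2) ℚ)ˣ) : Matrix (Fin 2) (Fin 2) ℚ) * z * u) 1 0 = M * n)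
    (g uR : GL (Fin 2) ℝ)
    (huR : uR = Units.map ((algebraMap ℚ ℝ).mapMatrix :
      Matrix (Fin 2) (Fin 2) ℚ →+* Matrix (Fin 2) (Fin 2) ℝ).toMonoidHom u)
    (hg : ∀ x : Matrix (Fin 2) (Fin 2) ℚ, (X.ι.comp (e.symm : Matrix (Fin 2) (Fin 2) ℚ →ₐ[ℚ] X.B)) x =
      (g : Matrix (Fin 2) (Fin 2) ℝ) * x.map (algebraMap ℚ ℝ) * ((g⁻¹ : GL (Fin 2) ℝ) : Matrix (Fin 2) (Fin 2) ℝ))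
    (m : Matrix (Fin 2) (Fin 2) ℝ) :
    (∃ x ∈ X.O, X.ι x = m) ↔ ∃ A : Matrix (Fin 2) (Fin 2) ℤ, (M : ℤ) ∣ A 1 0 ∧
      m = ((g * uR : GL (Fin 2) ℝ) : Matrix (Fin 2) (Fin 2) ℝ) * A.map (Int.cast : ℤ → ℝ) *
        (((g * uR)⁻¹ : GL (Fin 2) ℝ) : Matrix (Fin 2) (Fin 2) ℝ) := by
  -- the real cast of `u z u⁻¹`
  have hcast : ∀ A : Matrix (Fin 2) (Fin 2) ℤ,
      ((u : Matrix (Fin 2) (Fin 2) ℚ) * A.map (Int.cast : ℤ → ℚ) *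
        ((u⁻¹ : (Matrix (Fin 2) (Fin 2) ℚ)ˣ) : Matrix (Fin 2) (Fin 2) ℚ)).map (algebraMap ℚ ℝ) =
      (uR : Matrix (Fin 2) (Fin 2) ℝ) * A.map (Int.cast : ℤ → ℝ) *
        ((uR⁻¹ : GL (Fin 2) ℝ) : Matrix (Fin 2) (Fin 2) ℝ) := by
    intro A
    have hA : (A.map (Int.cast : ℤ → ℚ)).map (algebraMap ℚ ℝ) = A.map (Int.cast : ℤ → ℝ) := by
      ext i j
      simp only [Matrix.map_apply, eq_ratCast, Rat.cast_intCast]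
    rw [huR, Units.coe_map, Units.coe_map_inv, ← hA]
    change (algebraMap ℚ ℝ).mapMatrix _ = _
    rw [map_mul, map_mul]
    rfl
  constructor
  · rintro ⟨x, hxO, rfl⟩
    have hzO : e x ∈ X.O.map ((e : X.B ≃+* Matrix (Fin 2) (Fin 2) ℚ).toAddEquiv.toIntLinearEquiv :
        X.B →ₗ[ℤ] Matrix (Fin 2) (Fin 2) ℚ) :=
      (apply_mem_map_ringEquiv_iff (e : X.B ≃+* Matrix (Fin 2) (Fin 2) ℚ)).mpr hxO
    obtain ⟨hint, n, hn⟩ := (hu (e x)).mp hzO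
    choose Af hAf using hint
    set A : Matrix (Fin 2) (Fin 2) ℤ := Matrix.of fun i j => Af i j with hA
    have hAQ : ((u⁻¹ : (Matrix (Fin 2) (Fin 2) ℚ)ˣ) : Matrix (Fin 2) (Fin 2) ℚ) * e x * u =
        A.map (Int.cast : ℤ → ℚ) := by
      ext i j
      rw [Matrix.map_apply, hA, Matrix.of_apply, hAf i j]
    refine ⟨A, ⟨n, ?_⟩, ?_⟩
    · have h1 : ((A 1 0 : ℤ) : ℚ) = (M : ℚ) * n := by
        rw [← hn, hA, Matrix.of_apply, hAf 1 0]
      exact_mod_cast h1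
    · have hιx : X.ι x = (X.ι.comp (e.symm : Matrix (Fin 2) (Fin 2) ℚ →ₐ[ℚ] X.B)) (e x) := by
        rw [AlgHom.comp_apply]
        change X.ι x = X.ι (e.symm (e x))
        rw [AlgEquiv.symm_apply_apply]
      have hex : e x = (u : Matrix (Fin 2) (Fin 2) ℚ) * A.map (Int.cast : ℤ → ℚ) *
          ((u⁻¹ : (Matrix (Fin 2) (Fin 2) ℚ)ˣ) : Matrix (Fin 2) (Fin 2) ℚ) := by
        rw [← hAQ]
        simp only [← mul_assoc, Units.mul_inv, one_mul, Units.mul_inv_cancel_right]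
      rw [hιx, hg (e x), hex, hcast A]
      simp only [_root_.mul_inv_rev, Units.val_mul, mul_assoc]
  · rintro ⟨A, ⟨n, hn⟩, rfl⟩
    set z : Matrix (Fin 2) (Fin 2) ℚ := (u : Matrix (Fin 2) (Fin 2) ℚ) * A.map (Int.cast : ℤ → ℚ) *
      ((u⁻¹ : (Matrix (Fin 2) (Fin 2) ℚ)ˣ) : Matrix (Fin 2) (Fin 2) ℚ) with hz
    have hconj : ((u⁻¹ : (Matrix (Fin 2) (Fin 2) ℚ)ˣ) : Matrix (Fin 2) (Fin 2) ℚ) * z * u =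
        A.map (Int.cast : ℤ → ℚ) := by
      rw [hz, ← mul_assoc, ← mul_assoc, Units.inv_mul, one_mul, Units.inv_mul_cancel_right]
    have hzO : z ∈ X.O.map ((e : X.B ≃+* Matrix (Fin 2) (Fin 2) ℚ).toAddEquiv.toIntLinearEquiv :
        X.B →ₗ[ℤ] Matrix (Fin 2) (Fin 2) ℚ) := by
      rw [hu z, hconj]
      refine ⟨fun i j => ⟨A i j, by rw [Matrix.map_apply]⟩, ⟨n, ?_⟩⟩
      rw [Matrix.map_apply, hn, Int.cast_mul, Int.cast_natCast]
    refine ⟨e.symm z, (mem_map_ringEquiv_iff (e : X.B ≃+* Matrix (Fin 2) (Fin 2) ℚ)).mp hzO, ?_⟩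
    have hιx : X.ι (e.symm z) = (X.ι.comp (e.symm : Matrix (Fin 2) (Fin 2) ℚ →ₐ[ℚ] X.B)) z := rfl
    rw [hιx, hg z, hz, hcast A]
    simp only [_root_.mul_inv_rev, Units.val_mul, mul_assoc]

/-- The sign matrix `J = diag(-1, 1)` (Mathlib `UpperHalfPlane.J`, `det J = -1`) conjugates an
integer matrix to `(a, -b; -c, d)`; this preserves integrality and the level condition `M ∣ c`.
Hence replacing the conjugator `h₀` by `h₀ J` does not change the shape of the description in
`exists_mem_O_ι_eq_iff_of_data` (used to make `det h > 0`). [folklore] -/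
theorem exists_int_conj_eq_iff_of_sign (M : ℕ) (h₀ : GL (Fin 2) ℝ) (m : Matrix (Fin 2) (Fin 2) ℝ) :
    (∃ A : Matrix (Fin 2) (Fin 2) ℤ, (M : ℤ) ∣ A 1 0 ∧
      m = (h₀ : Matrix (Fin 2) (Fin 2) ℝ) * A.map (Int.cast : ℤ → ℝ) * ((h₀⁻¹ : GL (Fin 2) ℝ) : Matrix (Fin 2) (Fin 2) ℝ)) ↔
    ∃ A : Matrix (Fin 2) (Fin 2) ℤ, (M : ℤ) ∣ A 1 0 ∧
      m = ((h₀ * UpperHalfPlane.J : GL (Fin 2) ℝ) : Matrix (Fin 2) (Fin 2) ℝ) * A.map (Int.cast : ℤ → ℝ) *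
        (((h₀ * UpperHalfPlane.J)⁻¹ : GL (Fin 2) ℝ) : Matrix (Fin 2) (Fin 2) ℝ) := by
  have hJinv : (UpperHalfPlane.J⁻¹ : GL (Fin 2) ℝ) = UpperHalfPlane.J :=
    inv_eq_of_mul_eq_one_right (by rw [← sq, UpperHalfPlane.J_sq])
  -- `(h₀ J) A (h₀ J)⁻¹ = h₀ (J A J) h₀⁻¹` and `J A J = (a, -b; -c, d)`
  have key : ∀ A : Matrix (Fin 2) (Fin 2) ℤ,
      ((h₀ * UpperHalfPlane.J : GL (Fin 2) ℝ) : Matrix (Fin 2) (Fin 2) ℝ) * A.map (Int.cast : ℤ → ℝ) *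
        (((h₀ * UpperHalfPlane.J)⁻¹ : GL (Fin 2) ℝ) : Matrix (Fin 2) (Fin 2) ℝ) =
      (h₀ : Matrix (Fin 2) (Fin 2) ℝ) *
        (!![A 0 0, -A 0 1; -A 1 0, A 1 1] : Matrix (Fin 2) (Fin 2) ℤ).map (Int.cast : ℤ → ℝ) *
        ((h₀⁻¹ : GL (Fin 2) ℝ) : Matrix (Fin 2) (Fin 2) ℝ) := by
    intro A
    have hJAJ : ((UpperHalfPlane.J : GL (Fin 2) ℝ) : Matrix (Fin 2) (Fin 2) ℝ) * A.map (Int.cast : ℤ → ℝ) *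
        ((UpperHalfPlane.J : GL (Fin 2) ℝ) : Matrix (Fin 2) (Fin 2) ℝ) =
        (!![A 0 0, -A 0 1; -A 1 0, A 1 1] : Matrix (Fin 2) (Fin 2) ℤ).map (Int.cast : ℤ → ℝ) := by
      rw [show ((UpperHalfPlane.J : GL (Fin 2) ℝ) : Matrix (Fin 2) (Fin 2) ℝ) = !![-1, 0; 0, 1] from
          UpperHalfPlane.val_J, Matrix.eta_fin_two (A.map (Int.cast : ℤ → ℝ))]
      simp only [Matrix.map_apply, Matrix.mul_fin_two]
      ext i j
      fin_cases i <;> fin_cases j <;> simp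
    rw [_root_.mul_inv_rev, hJinv, Units.val_mul, Units.val_mul, ← hJAJ]
    simp only [mul_assoc]
  have hinv : ∀ A : Matrix (Fin 2) (Fin 2) ℤ,
      (!![(!![A 0 0, -A 0 1; -A 1 0, A 1 1] : Matrix (Fin 2) (Fin 2) ℤ) 0 0,
          -(!![A 0 0, -A 0 1; -A 1 0, A 1 1] : Matrix (Fin 2) (Fin 2) ℤ) 0 1;
          -(!![A 0 0, -A 0 1; -A 1 0, A 1 1] : Matrix (Fin 2) (Fin 2) ℤ) 1 0,
          (!![A 0 0, -A 0 1; -A 1 0, A 1 1] : Matrix (Fin 2) (Fin 2) ℤ) 1 1] : Matrix (Fin 2) (Fin 2) ℤ) = A := by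
    intro A
    rw [Matrix.eta_fin_two A]
    simp
  constructor
  · rintro ⟨A, hA, rfl⟩
    refine ⟨!![A 0 0, -A 0 1; -A 1 0, A 1 1], by simpa using hA, ?_⟩
    rw [key, hinv]
  · rintro ⟨A, hA, rfl⟩
    exact ⟨!![A 0 0, -A 0 1; -A 1 0, A 1 1], by simpa using hA, key A⟩

/-- **Conjugation data for a datum of discriminant `1`.** For `X : ShimuraCurveData 1 M` there is
`h ∈ GL₂(ℝ)` of POSITIVE determinant such that `ι(O) = h · {A ∈ M₂(ℤ) : M ∣ A₁₀} · h⁻¹`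
(entrywise real cast); moreover `0 < M`. Proof: `B ≃ M₂(ℚ)` (no ramification,
`nonempty_algEquiv_matrix_of_discr_one`), the Eichler order becomes `u (ℤ ℤ; Mℤ ℤ) u⁻¹`
(`exists_units_forall_mem_iff_and_pos`, Vignéras II §2), the real splitting is `x ↦ g x g⁻¹`
(Skolem–Noether, `exists_algHom_apply_eq_conj`); `h = g u`, corrected by the sign matrix `J` if
`det (g u) < 0`. [cite: VignerasLNM800, Ch. IV §1 exemple 4 (groupes de congruence) and Ch. II §2] -/
theorem ShimuraCurveData.exists_conj_of_discr_one (X : ShimuraCurveData 1 M) :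
    0 < M ∧ ∃ h : GL (Fin 2) ℝ, 0 < h.det.val ∧
      ∀ m : Matrix (Fin 2) (Fin 2) ℝ, (∃ x ∈ X.O, X.ι x = m) ↔
        ∃ A : Matrix (Fin 2) (Fin 2) ℤ, (M : ℤ) ∣ A 1 0 ∧
          m = (h : Matrix (Fin 2) (Fin 2) ℝ) * A.map (Int.cast : ℤ → ℝ) *
            ((h⁻¹ : GL (Fin 2) ℝ) : Matrix (Fin 2) (Fin 2) ℝ) := by
  obtain ⟨e⟩ := X.nonempty_algEquiv_matrix_of_discr_one
  have hO' : Brandt.IsEichlerOrder (Matrix (Fin 2) (Fin 2) ℚ)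
      (X.O.map ((e : X.B ≃+* Matrix (Fin 2) (Fin 2) ℚ).toAddEquiv.toIntLinearEquiv :
        X.B →ₗ[ℤ] Matrix (Fin 2) (Fin 2) ℚ)) M :=
    X.isEichlerOrder.map_ringEquiv (e : X.B ≃+* Matrix (Fin 2) (Fin 2) ℚ)
  obtain ⟨u, hMpos, hu⟩ := hO'.exists_units_forall_mem_iff_and_pos
  obtain ⟨g, hg⟩ := Literature.LinearAlgebra.Matrix.exists_algHom_apply_eq_conj
    (X.ι.comp (e.symm : Matrix (Fin 2) (Fin 2) ℚ →ₐ[ℚ] X.B))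
  set uR : GL (Fin 2) ℝ :=
    Units.map ((algebraMap ℚ ℝ).mapMatrix : Matrix (Fin 2) (Fin 2) ℚ →+* Matrix (Fin 2) (Fin 2) ℝ).toMonoidHom u
    with huR
  have H := X.exists_mem_O_ι_eq_iff_of_data e u hu g uR huR hg
  refine ⟨hMpos, ?_⟩
  rcases lt_or_gt_of_ne (g * uR).det.ne_zero with hneg | hpos
  · refine ⟨g * uR * UpperHalfPlane.J, ?_, fun m => (H m).trans
      (exists_int_conj_eq_iff_of_sign M (g * uR) m)⟩
    rw [map_mul, UpperHalfPlane.det_J, Units.val_mul, Units.val_neg, Units.val_one]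
    nlinarith
  · exact ⟨g * uR, hpos, H⟩

/-- The determinant of the real cast of an integer matrix (the tree's `det_map_intCast` is the
rational cast). [folklore] -/
theorem det_map_intCast_real (A : Matrix (Fin 2) (Fin 2) ℤ) :
    (A.map (Int.cast : ℤ → ℝ)).det = (A.det : ℝ) := by
  have h := (Int.castRingHom ℝ).map_det A
  rw [eq_intCast] at h
  exact h.symm

/-- **`ι(O¹)` is conjugate to `Γ₀(M)` by the conjugator of `exists_conj_of_discr_one`**:
if `ι(O) = h {A ∈ M₂(ℤ) : M ∣ A₁₀} h⁻¹` then `h⁻¹ Γ₀^1(M) h = Γ₀(M)` (image of Mathlib's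
`CongruenceSubgroup.Gamma0 M` in `GL₂(ℝ)`). [cite: VignerasLNM800, Ch. IV §1 exemple 4 (groupes de congruence)] -/
theorem ShimuraCurveData.conjAct_inv_smul_Gamma_eq_of_conj (X : ShimuraCurveData 1 M)
    {h : GL (Fin 2) ℝ}
    (H : ∀ m : Matrix (Fin 2) (Fin 2) ℝ, (∃ x ∈ X.O, X.ι x = m) ↔
      ∃ A : Matrix (Fin 2) (Fin 2) ℤ, (M : ℤ) ∣ A 1 0 ∧
        m = (h : Matrix (Fin 2) (Fin 2) ℝ) * A.map (Int.cast : ℤ → ℝ) *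
          ((h⁻¹ : GL (Fin 2) ℝ) : Matrix (Fin 2) (Fin 2) ℝ)) :
    ConjAct.toConjAct h⁻¹ • X.Gamma =
      (CongruenceSubgroup.Gamma0 M).map (Matrix.SpecialLinearGroup.mapGL ℝ) := by
  ext γ
  rw [mem_conjAct_inv_smul_iff, Subgroup.mem_map]
  constructor
  · rintro ⟨hx, -, hdet⟩
    obtain ⟨A, ⟨n, hn⟩, hA⟩ := (H _).mp hx
    -- `γ = A` over `ℝ`
    have hγ : (γ : Matrix (Fin 2) (Fin 2) ℝ) = A.map (Int.cast : ℤ → ℝ) := by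
      have e1 : (γ : Matrix (Fin 2) (Fin 2) ℝ) = ((h⁻¹ : GL (Fin 2) ℝ) : Matrix (Fin 2) (Fin 2) ℝ) *
          ((h * γ * h⁻¹ : GL (Fin 2) ℝ) : Matrix (Fin 2) (Fin 2) ℝ) * (h : Matrix (Fin 2) (Fin 2) ℝ) := by
        rw [← Units.val_mul, ← Units.val_mul]
        congr 1
        group
      rw [e1, hA]
      simp only [← mul_assoc, Units.inv_mul, one_mul]
      rw [mul_assoc, Units.inv_mul, mul_one]
    have hdetγ : Matrix.GeneralLinearGroup.det γ = 1 := by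
      rw [map_mul, map_mul, map_inv, mul_inv_cancel_comm] at hdet
      exact hdet
    have hdetA : A.det = 1 := by
      have h1 : Matrix.det (γ : Matrix (Fin 2) (Fin 2) ℝ) = 1 := by
        simpa using congrArg Units.val hdetγ
      rw [hγ, det_map_intCast_real] at h1
      exact_mod_cast h1
    refine ⟨⟨A, hdetA⟩, ?_, ?_⟩
    · rw [CongruenceSubgroup.Gamma0_mem]
      exact (ZMod.intCast_zmod_eq_zero_iff_dvd _ M).mpr ⟨n, hn⟩
    · apply Units.ext
      rw [Matrix.SpecialLinearGroup.mapGL_coe_matrix, hγ]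
      rfl
  · rintro ⟨w, hw, rfl⟩
    have hmem : ∀ w : SL(2, ℤ), w ∈ CongruenceSubgroup.Gamma0 M →
        ∃ x ∈ X.O, X.ι x = ((h * Matrix.SpecialLinearGroup.mapGL ℝ w * h⁻¹ : GL (Fin 2) ℝ) :
          Matrix (Fin 2) (Fin 2) ℝ) := by
      intro w hw
      refine (H _).mpr ⟨w, ?_, ?_⟩
      · exact (ZMod.intCast_zmod_eq_zero_iff_dvd _ M).mp (CongruenceSubgroup.Gamma0_mem.mp hw)
      · rw [Units.val_mul, Units.val_mul, Matrix.SpecialLinearGroup.mapGL_coe_matrix]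
        rfl
    refine ⟨hmem w hw, ?_, ?_⟩
    · obtain ⟨y, hyO, hy⟩ := hmem w⁻¹ (inv_mem hw)
      refine ⟨y, hyO, ?_⟩
      rw [hy, map_inv]
      congr 1
      group
    · rw [map_mul, map_mul, map_inv, mul_inv_cancel_comm, Matrix.SpecialLinearGroup.det_mapGL]

/-- **The Hecke sets of a datum of discriminant `1`**: with `h` as in `exists_conj_of_discr_one`,
`ι(O(n)) = h · Δ(n) · h⁻¹` where `Δ(n) = {A ∈ M₂(ℤ) : det A = n, M ∣ A₁₀}` (for `n ≠ 0`, through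
the tree's `intGL`). [folklore] -/
theorem ShimuraCurveData.mem_heckeSet_iff_of_conj (X : ShimuraCurveData 1 M) {h : GL (Fin 2) ℝ}
    (H : ∀ m : Matrix (Fin 2) (Fin 2) ℝ, (∃ x ∈ X.O, X.ι x = m) ↔
      ∃ A : Matrix (Fin 2) (Fin 2) ℤ, (M : ℤ) ∣ A 1 0 ∧
        m = (h : Matrix (Fin 2) (Fin 2) ℝ) * A.map (Int.cast : ℤ → ℝ) *
          ((h⁻¹ : GL (Fin 2) ℝ) : Matrix (Fin 2) (Fin 2) ℝ))
    {n : ℕ} (hn : n ≠ 0) (g : GL (Fin 2) ℝ) :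
    g ∈ X.heckeSet n ↔ ∃ A : Matrix (Fin 2) (Fin 2) ℤ, A.det = n ∧ (M : ℤ) ∣ A 1 0 ∧
      g = h * intGL A * h⁻¹ := by
  have hcoe : ∀ A : Matrix (Fin 2) (Fin 2) ℤ, A.det ≠ 0 →
      ((intGL A : GL (Fin 2) ℝ) : Matrix (Fin 2) (Fin 2) ℝ) = A.map (Int.cast : ℤ → ℝ) := by
    intro A hA
    rw [coe_intGL hA]
    rfl
  change ((∃ x ∈ X.O, X.ι x = (g : Matrix (Fin 2) (Fin 2) ℝ)) ∧
    (g : Matrix (Fin 2) (Fin 2) ℝ).det = n) ↔ _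
  rw [H]
  constructor
  · rintro ⟨⟨A, hA10, hA⟩, hdet⟩
    have hdetA : A.det = n := by
      rw [hA, Matrix.det_units_conj, det_map_intCast_real] at hdet
      exact_mod_cast hdet
    have hA0 : A.det ≠ 0 := by
      rw [hdetA]
      exact_mod_cast hn
    refine ⟨A, hdetA, hA10, Units.ext ?_⟩
    rw [Units.val_mul, Units.val_mul, hcoe A hA0, hA]
  · rintro ⟨A, hdetA, hA10, rfl⟩
    have hA0 : A.det ≠ 0 := by
      rw [hdetA]
      exact_mod_cast hn
    refine ⟨⟨A, hA10, ?_⟩, ?_⟩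
    · rw [Units.val_mul, Units.val_mul, hcoe A hA0]
    · rw [Units.val_mul, Units.val_mul, Matrix.det_units_conj, hcoe A hA0, det_map_intCast_real, hdetA]
      rfl

end SplitConj

section Transport

variable {M : ℕ}

/-- A cusp form is a cusp form for any level EQUAL to its own (transport along an equality of
subgroups, with the same underlying function). [folklore] -/
theorem exists_cuspForm_coe_eq_of_level_eq {Γ₁ Γ₂ : Subgroup (GL (Fin 2) ℝ)} (hΓ : Γ₁ = Γ₂)
    {k : ℤ} (F : CuspForm Γ₁ k) : ∃ F' : CuspForm Γ₂ k, (⇑F' : ℍ → ℂ) = ⇑F := by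
  subst hΓ
  exact ⟨F, rfl⟩

/-- **The transported form.** If `h⁻¹ Γ₀^1(M) h = Γ₀(M)` then for `f ∈ S₂(Γ₀(M))` and `c ∈ ℂ`,
`c · (f ∣[2] h⁻¹)` is (the function of) a weight-`2` cusp form on `Γ₀^1(M) = X.Gamma` (Mathlib
`CuspForm.translate`). [folklore] -/
theorem ShimuraCurveData.exists_cuspForm_coe_eq_smul_slash (X : ShimuraCurveData 1 M)
    {h : GL (Fin 2) ℝ} (hΓ : toConjAct h⁻¹ • X.Gamma = (Gamma0 M).map (mapGL ℝ))
    (f : CuspForm (Gamma0 M) 2) (c : ℂ) :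
    ∃ F : CuspForm X.Gamma 2, (⇑F : ℍ → ℂ) = c • (⇑f ∣[(2 : ℤ)] h⁻¹) := by
  have hΓ' : toConjAct h⁻¹⁻¹ • ((Gamma0 M).map (mapGL ℝ)) = X.Gamma := by
    rw [← hΓ, smul_smul, ← map_mul, inv_inv, mul_inv_cancel, map_one, one_smul]
  obtain ⟨F₀, hF₀⟩ := exists_cuspForm_coe_eq_of_level_eq hΓ' (CuspForm.translate f h⁻¹)
  refine ⟨c • F₀, ?_⟩
  rw [CuspForm.IsGLPos.coe_smul, hF₀]
  rfl

/-- `σ_g` is the identity for `g` of positive determinant. [folklore] -/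
theorem σ_apply_of_det_pos {g : GL (Fin 2) ℝ} (hg : 0 < g.det.val) (x : ℂ) : σ g x = x := by
  rw [σ, if_pos hg]
  rfl

/-- **The primitive of the transported form.** For `g ∈ GL₂(ℝ)` of positive determinant,
`w ↦ c · 2πi∫_{i∞}^{g w} f` is holomorphic on `ℍ` with derivative `c · 2πi · (f ∣[2] g)(w)`
(chain rule: `d(g w)/dw = det g / j(g, w)²`, Mathlib `UpperHalfPlane.hasStrictDerivAt_smul`, and
`d/dτ 2πi∫_{i∞}^τ f = 2πi f(τ)`, the tree's `hasDerivAt_eichlerIntegral`). [folklore] -/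
theorem hasDerivAt_eichlerIntegral_smul {N : ℕ} [NeZero N] (f : CuspForm (Gamma0 N) 2)
    {g : GL (Fin 2) ℝ} (hg : 0 < g.det.val) (c : ℂ) {z : ℂ} (hz : 0 < z.im) :
    HasDerivAt (fun w : ℂ ↦ c * eichlerIntegral f (g • ofComplex w))
      (((c * (2 * Real.pi * Complex.I)) • (⇑f ∣[(2 : ℤ)] g)) (ofComplex z)) z := by
  have hg' : 0 < g.val.det := by rwa [← Matrix.GeneralLinearGroup.val_det_apply]
  set τ : ℍ := ofComplex z with hτdef
  have hτ : (τ : ℂ) = z := by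
    rw [hτdef, ofComplex_apply_of_im_pos hz]
  rw [← hτ]
  have h1 : HasDerivAt (fun w : ℂ ↦ ((g • ofComplex w : ℍ) : ℂ)) ((g.val.det : ℂ) / denom g τ ^ 2) τ :=
    (UpperHalfPlane.hasStrictDerivAt_smul hg' τ).hasDerivAt
  have h2 : HasDerivAt (fun w : ℂ ↦ eichlerIntegral f (ofComplex w))
      (2 * Real.pi * Complex.I * f (ofComplex ((g • ofComplex (τ : ℂ) : ℍ) : ℂ)))
      ((g • ofComplex (τ : ℂ) : ℍ) : ℂ) :=
    hasDerivAt_eichlerIntegral f (g • ofComplex (τ : ℂ)).im_pos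
  have h3 := (h2.comp (τ : ℂ) h1).const_mul c
  simp only [ofComplex_apply] at h3
  have heq : (fun w : ℂ ↦ c * eichlerIntegral f (g • ofComplex w)) =
      fun w : ℂ ↦ c * ((fun w : ℂ ↦ eichlerIntegral f (ofComplex w)) ∘
        fun w : ℂ ↦ ((g • ofComplex w : ℍ) : ℂ)) w := by
    funext w
    simp only [Function.comp_apply, ofComplex_apply]
  rw [heq]
  refine h3.congr_deriv ?_
  rw [Pi.smul_apply, ModularForm.slash_apply, σ_apply_of_det_pos hg,
    smul_eq_mul, abs_of_pos hg, Matrix.GeneralLinearGroup.val_det_apply]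
  have hd : denom g τ ≠ 0 := denom_ne_zero g τ
  rw [show (2 : ℤ) - 1 = 1 by norm_num, zpow_one, zpow_neg, zpow_two]
  field_simp

/-- **Periods of the transported form.** With `h` of positive determinant conjugating `X.Gamma`
to `Γ₀(M)`, a form `F` on `X.Gamma` with `F = c · 2πi · (f ∣[2] h⁻¹)` has
`∫_z^w F = c · EI_f(h⁻¹ w) − c · EI_f(h⁻¹ z)` (`EI_f = 2πi ∫_{i∞} f`), and if `c Λ_f ⊆ Λ` then all
its periods on `X.Gamma` lie in `Λ` (`EI_f(γ₀ τ) − EI_f(τ) ∈ Λ_f`, the tree's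
`eichlerIntegral_gamma_smul_holds`). [folklore] -/
theorem ShimuraCurveData.segmentIntegral_eq_and_hasPeriodsIn_of_conj [NeZero M]
    (X : ShimuraCurveData 1 M) {h : GL (Fin 2) ℝ} (hdet : 0 < h.det.val)
    (hΓ : toConjAct h⁻¹ • X.Gamma = (Gamma0 M).map (mapGL ℝ))
    (f : CuspForm (Gamma0 M) 2) (c : ℂ) (F : CuspForm X.Gamma 2)
    (hF : (⇑F : ℍ → ℂ) = (c * (2 * Real.pi * Complex.I)) • (⇑f ∣[(2 : ℤ)] h⁻¹))
    {Λ : AddSubgroup ℂ} (hc : ∀ z ∈ periodLattice f, c * z ∈ Λ) :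
    (∀ z w : ℍ, segmentIntegral F z w =
      c * eichlerIntegral f (h⁻¹ • w) - c * eichlerIntegral f (h⁻¹ • z)) ∧
    HasPeriodsIn X.Gamma F (Λ : Set ℂ) := by
  have hdet' : 0 < (h⁻¹).det.val := by
    rw [map_inv, Units.val_inv_eq_inv_val]
    exact inv_pos.mpr hdet
  have hG : ∀ z : ℂ, 0 < z.im →
      HasDerivAt (fun w : ℂ ↦ c * eichlerIntegral f (h⁻¹ • ofComplex w)) (F (ofComplex z)) z := by
    intro z hz
    have := hasDerivAt_eichlerIntegral_smul f hdet' c hz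
    rwa [← hF] at this
  have hseg : ∀ z w : ℍ, segmentIntegral F z w =
      c * eichlerIntegral f (h⁻¹ • w) - c * eichlerIntegral f (h⁻¹ • z) := by
    intro z w
    rw [segmentIntegral_eq_sub F hG z w]
    simp only [ofComplex_apply]
  refine ⟨hseg, fun γ hγ z => ?_⟩
  -- `h⁻¹ γ h = w ∈ Γ₀(M)`
  have hmem : h⁻¹ * γ * h ∈ toConjAct h⁻¹ • X.Gamma := by
    rw [mem_conjAct_inv_smul_iff]
    simpa only [← mul_assoc, mul_inv_cancel, one_mul, mul_inv_cancel_right] using hγ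
  rw [hΓ, Subgroup.mem_map] at hmem
  obtain ⟨w, hw, hwγ⟩ := hmem
  have hsmul : h⁻¹ • γ • z = (w : SL(2, ℤ)) • (h⁻¹ • z) := by
    rw [ModularGroup.sl_moeb, smul_smul, smul_smul]
    congr 1
    rw [show ((w : SL(2, ℤ)) : GL (Fin 2) ℝ) = mapGL ℝ w from rfl, hwγ]
    group
  rw [SetLike.mem_coe, hseg, hsmul, ← mul_sub]
  exact hc _ (eichlerIntegral_gamma_smul_holds f ⟨w, hw⟩ (h⁻¹ • z))

end Transport

section Hecke

variable {M : ℕ}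

/-- `(c • f) ∣[k] g = c • (f ∣[k] g)` for `g` of positive determinant. [folklore] -/
theorem smul_slash_of_det_pos {k : ℤ} {g : GL (Fin 2) ℝ} (hg : 0 < g.det.val) (c : ℂ) (f : ℍ → ℂ) :
    (c • f) ∣[k] g = c • (f ∣[k] g) := by
  rw [ModularForm.smul_slash, σ_apply_of_det_pos hg]

/-- The determinant of `intGL A` is `det A`. [folklore] -/
theorem det_intGL_val {A : Matrix (Fin 2) (Fin 2) ℤ} (hA : A.det ≠ 0) :
    (intGL A : GL (Fin 2) ℝ).det.val = (A.det : ℝ) := by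
  rw [Matrix.GeneralLinearGroup.val_det_apply, coe_intGL hA, ← RingHom.mapMatrix_apply,
    ← RingHom.map_det, eq_intCast]

/-- For `ℓ` prime to `M`, an integer matrix of determinant `ℓ` with `M ∣ A₁₀` lies in `Δ₀ᴹ(ℓ)`
(the coprimality `gcd(A₀₀, M) = 1` is automatic: `A₀₀ A₁₁ ≡ ℓ (mod M)`). [folklore] -/
theorem mem_delta0_of_det_of_dvd {ℓ : ℕ} (hℓ : ℓ.Prime) (hℓM : ¬ ℓ ∣ M) {A : Matrix (Fin 2) (Fin 2) ℤ}
    (hdet : A.det = ℓ) (h10 : (M : ℤ) ∣ A 1 0) : A ∈ Delta0 M (ℓ * 1) := by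
  refine ⟨by rw [mul_one, hdet], h10, ?_⟩
  obtain ⟨c, hc⟩ := h10
  have hℓM' : IsCoprime (ℓ : ℤ) (M : ℤ) :=
    Nat.isCoprime_iff_coprime.2 ((Nat.Prime.coprime_iff_not_dvd hℓ).2 hℓM)
  obtain ⟨u, v, huv⟩ := hℓM'
  rw [Matrix.det_fin_two] at hdet
  -- `A₀₀ A₁₁ - A₀₁ (M c) = ℓ` and `u ℓ + v M = 1`
  refine ⟨u * A 1 1, v - u * A 0 1 * c, ?_⟩
  linear_combination huv + u * hdet + u * A 0 1 * hc

variable (X : ShimuraCurveData 1 M) {h : GL (Fin 2) ℝ}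
  (H : ∀ m : Matrix (Fin 2) (Fin 2) ℝ, (∃ x ∈ X.O, X.ι x = m) ↔
    ∃ A : Matrix (Fin 2) (Fin 2) ℤ, (M : ℤ) ∣ A 1 0 ∧
      m = (h : Matrix (Fin 2) (Fin 2) ℝ) * A.map (Int.cast : ℤ → ℝ) *
        ((h⁻¹ : GL (Fin 2) ℝ) : Matrix (Fin 2) (Fin 2) ℝ))

include H in
/-- **The transversal `T_i = h β_i h⁻¹` lies in `ι(O(ℓ))`** (`β_i` the classical representatives
`(1 j; 0 ℓ)`, `diag(ℓ, 1)` of `Γ₀(M) \ Γ₀(M) diag(1, ℓ) Γ₀(M)`, the tree's `heckeRep`). [folklore] -/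
theorem ShimuraCurveData.conj_intGL_heckeRep_mem_heckeSet {ℓ : ℕ} (hℓ : ℓ.Prime) (i : HeckeIdx M ℓ) :
    h * intGL (heckeRep ℓ i.1) * h⁻¹ ∈ X.heckeSet ℓ := by
  rw [X.mem_heckeSet_iff_of_conj H hℓ.ne_zero]
  refine ⟨heckeRep ℓ i.1, det_heckeRep ℓ i.1, ?_, rfl⟩
  rcases i with ⟨_ | j, hi⟩ <;> simp [heckeRep]

include H in
/-- **Coset decomposition of `ι(O(ℓ))`**: for `ℓ` prime, `ℓ ∤ M`, every element of `ι(O(ℓ))` is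
`γ T_i` for a unique index `i ∈ I_ℓ(M)` and some `γ ∈ Γ₀^1(M)` — the conjugate by `h` of the
classical decomposition `Δ₀ᴹ(ℓ) = ⊔ᵢ Γ₀(M) βᵢ` (Diamond–Shurman Prop. 5.2.1; tree
`existsUnique_mem_delta0_mul_heckeRep`). [cite: DiamondShurman2005, Prop. 5.2.1 and Exercise 5.2.4] -/
theorem ShimuraCurveData.existsUnique_heckeIdx_of_mem_heckeSet
    (hΓ : toConjAct h⁻¹ • X.Gamma = (Gamma0 M).map (mapGL ℝ))
    {ℓ : ℕ} (hℓ : ℓ.Prime) (hℓM : ¬ ℓ ∣ M) {s : GL (Fin 2) ℝ} (hs : s ∈ X.heckeSet ℓ) :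
    ∃! i : HeckeIdx M ℓ, ∃ γ ∈ X.Gamma, γ * (h * intGL (heckeRep ℓ i.1) * h⁻¹) = s := by
  rw [X.mem_heckeSet_iff_of_conj H hℓ.ne_zero] at hs
  obtain ⟨A, hdetA, hA10, rfl⟩ := hs
  have hA0 : A.det ≠ 0 := by
    rw [hdetA]
    exact_mod_cast hℓ.ne_zero
  have hA : A ∈ Delta0 M (ℓ * 1) := mem_delta0_of_det_of_dvd hℓ hℓM hdetA hA10
  have hℓ1 : ¬ (ℓ : ℤ) ∣ 1 := by
    intro hd
    have : ℓ ∣ 1 := by exact_mod_cast hd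
    exact hℓ.one_lt.ne' (Nat.dvd_one.mp this)
  obtain ⟨i, ⟨A', hA', hAi⟩, huniq⟩ := existsUnique_mem_delta0_mul_heckeRep hℓ hℓ1 hA
  have hmemΓ : ∀ w : SL(2, ℤ), w ∈ Gamma0 M → h * mapGL ℝ w * h⁻¹ ∈ X.Gamma := by
    intro w hw
    have hw' : mapGL ℝ w ∈ toConjAct h⁻¹ • X.Gamma := by
      rw [hΓ]
      exact ⟨w, hw, rfl⟩
    rwa [mem_conjAct_inv_smul_iff] at hw'
  refine ⟨i, ?_, ?_⟩
  · obtain ⟨w, hw, hwA'⟩ :=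
      (exists_mem_delta0_one_iff (fun B => B * heckeRep ℓ i.1 = A)).mp ⟨A', hA', hAi⟩
    refine ⟨h * mapGL ℝ w * h⁻¹, hmemΓ w hw, ?_⟩
    rw [mapGL_eq_intGL, ← hwA', intGL_mul (by simp) (det_heckeRep_ne_zero hℓ.ne_zero _)]
    group
  · rintro j ⟨γ, hγ, hγeq⟩
    have hmem : h⁻¹ * γ * h ∈ toConjAct h⁻¹ • X.Gamma := by
      rw [mem_conjAct_inv_smul_iff]
      simpa only [← mul_assoc, mul_inv_cancel, one_mul, mul_inv_cancel_right] using hγ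
    rw [hΓ, Subgroup.mem_map] at hmem
    obtain ⟨w', hw', hw'eq⟩ := hmem
    have e1 : intGL ((w' : Matrix (Fin 2) (Fin 2) ℤ) * heckeRep ℓ j.1) = intGL A := by
      rw [intGL_mul (by simp) (det_heckeRep_ne_zero hℓ.ne_zero _), ← mapGL_eq_intGL, hw'eq]
      calc h⁻¹ * γ * h * intGL (heckeRep ℓ j.1)
          = h⁻¹ * (γ * (h * intGL (heckeRep ℓ j.1) * h⁻¹)) * h := by group
        _ = h⁻¹ * (h * intGL A * h⁻¹) * h := by rw [hγeq]
        _ = intGL A := by group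
    have e2 : (w' : Matrix (Fin 2) (Fin 2) ℤ) * heckeRep ℓ j.1 = A :=
      intGL_inj (by simp [Matrix.det_mul, hℓ.ne_zero]) hA0 e1
    obtain ⟨B, hB, hBw⟩ :=
      (exists_mem_delta0_one_iff (fun B => B = (w' : Matrix (Fin 2) (Fin 2) ℤ))).mpr ⟨w', hw', rfl⟩
    rw [hBw] at hB
    exact huniq j ⟨w', hB, e2⟩

include H in
/-- **`T_ℓ` on the transported side as a finite sum over the classical representatives**:
for `ℓ` prime, `ℓ ∤ M` and `F ∈ S₂(Γ₀^1(M))`, `X.heckeFun ℓ F = ∑_{i ∈ I_ℓ(M)} F ∣[2] (h βᵢ h⁻¹)`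
(the `finsum` over `Γ₀^1(M) \ ι(O(ℓ))` re-indexed by the bijection `i ↦ [h βᵢ h⁻¹]`; the summands
do not depend on the representatives since `F` is `Γ₀^1(M)`-invariant). [cite: DiamondShurman2005, Prop. 5.2.1 and Exercise 5.1.3] -/
theorem ShimuraCurveData.heckeFun_eq_sum_of_conj
    (hΓ : toConjAct h⁻¹ • X.Gamma = (Gamma0 M).map (mapGL ℝ))
    {ℓ : ℕ} (hℓ : ℓ.Prime) (hℓM : ¬ ℓ ∣ M) (F : CuspForm X.Gamma 2) (τ : ℍ) :
    haveI : NeZero ℓ := ⟨hℓ.ne_zero⟩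
    X.heckeFun ℓ F τ =
      (∑ i : HeckeIdx M ℓ, ⇑F ∣[(2 : ℤ)] (h * intGL (heckeRep ℓ i.1) * h⁻¹)) τ := by
  classical
  haveI : NeZero ℓ := ⟨hℓ.ne_zero⟩
  set T : HeckeIdx M ℓ → X.heckeSet ℓ := fun i =>
    ⟨h * intGL (heckeRep ℓ i.1) * h⁻¹, X.conj_intGL_heckeRep_mem_heckeSet H hℓ i⟩ with hT
  set Φ : HeckeIdx M ℓ → Quotient (X.heckeSetoid ℓ) := fun i =>
    Quotient.mk (X.heckeSetoid ℓ) (T i) with hΦdef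
  have hΦ : Function.Bijective Φ := by
    constructor
    · intro i j hij
      obtain ⟨γ, hγ, hγeq⟩ := Quotient.exact hij
      obtain ⟨i', -, huniq⟩ := X.existsUnique_heckeIdx_of_mem_heckeSet H hΓ hℓ hℓM (T j).2
      exact (huniq i ⟨γ, hγ, hγeq⟩).trans (huniq j ⟨1, one_mem _, one_mul _⟩).symm
    · intro q
      induction q using Quotient.inductionOn with
      | h s =>
        obtain ⟨i, ⟨γ, hγ, hγeq⟩, -⟩ := X.existsUnique_heckeIdx_of_mem_heckeSet H hΓ hℓ hℓM s.2
        exact ⟨i, Quotient.sound ⟨γ, hγ, by rw [hγeq]⟩⟩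
  have hterm : ∀ i : HeckeIdx M ℓ,
      (⇑F ∣[(2 : ℤ)] (h * intGL (heckeRep ℓ i.1) * h⁻¹)) τ =
        (⇑F ∣[(2 : ℤ)] (((Φ i).out : X.heckeSet ℓ) : GL (Fin 2) ℝ)) τ := by
    intro i
    obtain ⟨γ, hγ, hγeq⟩ := @Quotient.mk_out _ (X.heckeSetoid ℓ) (T i)
    -- `γ · out = T i`, so `F ∣ out = F ∣ γ⁻¹ T i = F ∣ T i`
    have hout : (((Φ i).out : X.heckeSet ℓ) : GL (Fin 2) ℝ) = γ⁻¹ * (h * intGL (heckeRep ℓ i.1) * h⁻¹) := by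
      rw [eq_inv_mul_iff_mul_eq, hγeq]
    conv_rhs => rw [hout, SlashAction.slash_mul,
      SlashInvariantFormClass.slash_action_eq F γ⁻¹ (inv_mem hγ)]
  unfold ShimuraCurveData.heckeFun
  rw [← finsum_eq_of_bijective Φ hΦ hterm, finsum_eq_sum_of_fintype, Finset.sum_apply]

include H in
/-- **The Hecke condition transports.** If `F = C · (f ∣[2] h⁻¹)` on `Γ₀^1(M) = h Γ₀(M) h⁻¹`
(`det h > 0`) and `T_ℓ f = a f` for the classical `T_ℓ` on `S₂(Γ₀(M))` (`ℓ` prime, `ℓ ∤ M`), then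
`T_ℓ F = a F` for the Hecke operator `X.heckeFun ℓ` of the datum: both are sums over the same
`ℓ + 1` cosets, `h βᵢ h⁻¹` resp. `βᵢ` (Diamond–Shurman Prop. 5.2.1; Pasten §4.8 for `T_{U,n}`).
[cite: DiamondShurman2005, Prop. 5.2.1] [cite: PastenShimura2024, §4.8 p. 15 (Hecke action)] -/
theorem ShimuraCurveData.heckeFun_eq_mul_of_conj [NeZero M] (hdet : 0 < h.det.val)
    (hΓ : toConjAct h⁻¹ • X.Gamma = (Gamma0 M).map (mapGL ℝ))
    (f : CuspForm (Gamma0 M) 2) (C : ℂ) (F : CuspForm X.Gamma 2)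
    (hF : (⇑F : ℍ → ℂ) = C • (⇑f ∣[(2 : ℤ)] h⁻¹)) {ℓ : ℕ} (hℓ : ℓ.Prime) (hℓM : ¬ ℓ ∣ M) {a : ℂ}
    (hT : (⇑(haveI : NeZero ℓ := ⟨hℓ.ne_zero⟩; heckeT (Gamma0 M) 2 ℓ f) : ℍ → ℂ) = a • ⇑f) :
    X.heckeFun ℓ F = fun τ => a * F τ := by
  haveI : NeZero ℓ := ⟨hℓ.ne_zero⟩
  have hdet' : 0 < (h⁻¹).det.val := by
    rw [map_inv, Units.val_inv_eq_inv_val]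
    exact inv_pos.mpr hdet
  funext τ
  rw [X.heckeFun_eq_sum_of_conj H hΓ hℓ hℓM F τ]
  have hterm : ∀ i : HeckeIdx M ℓ, ⇑F ∣[(2 : ℤ)] (h * intGL (heckeRep ℓ i.1) * h⁻¹) =
      C • ((⇑f ∣[(2 : ℤ)] intGL (heckeRep ℓ i.1)) ∣[(2 : ℤ)] h⁻¹) := by
    intro i
    have hβ : 0 < (intGL (heckeRep ℓ i.1) : GL (Fin 2) ℝ).det.val := by
      rw [det_intGL_val (det_heckeRep_ne_zero hℓ.ne_zero _), det_heckeRep]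
      exact_mod_cast hℓ.pos
    have hfh : (⇑f ∣[(2 : ℤ)] h⁻¹) ∣[(2 : ℤ)] h = ⇑f := by
      rw [← SlashAction.slash_mul, inv_mul_cancel, SlashAction.slash_one]
    rw [SlashAction.slash_mul, SlashAction.slash_mul, hF, smul_slash_of_det_pos hdet, hfh,
      smul_slash_of_det_pos hβ, smul_slash_of_det_pos hdet']
  simp only [hterm]
  rw [← Finset.smul_sum, ← finset_sum_slash, ← coe_heckeT_gamma0 M 2 ℓ hℓ f, hT,
    smul_slash_of_det_pos hdet', hF]
  simp only [Pi.smul_apply, smul_eq_mul]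
  ring

end Hecke

section Orbits

variable {M : ℕ}

open Literature.NumberTheory.EllipticCurves.ModularForms (Y0 Y0.mk Y0.mk_eq_mk_iff Y0.mk_surjective)

/-- **Orbit spaces of conjugate groups.** If `h⁻¹ Γ₀^1(M) h = Γ₀(M)` then `Γ₀^1(M)τ ↦ Γ₀(M)(h⁻¹τ)`
is a well-defined bijection `Γ₀^1(M)∖ℍ → Y₀(M)`; consequently, for maps `G` on `ℍ` and `Ψ` with
`G(τ) = Ψ(h⁻¹ τ)`, the number of `Γ₀^1(M)`-orbits meeting `G⁻¹(P)` equals the number of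
`Γ₀(M)`-orbits meeting `Ψ⁻¹(P)`, for every `P`. [folklore] -/
theorem ShimuraCurveData.card_orbitFibre_eq_of_conj (X : ShimuraCurveData 1 M) {h : GL (Fin 2) ℝ}
    (hΓ : toConjAct h⁻¹ • X.Gamma = (Gamma0 M).map (mapGL ℝ))
    {A : Type*} (Ψ G : ℍ → A) (hG : ∀ τ, G τ = Ψ (h⁻¹ • τ)) (P : A) :
    Nat.card {y : MulAction.orbitRel.Quotient X.Gamma ℍ // ∃ τ : ℍ,
        (Quotient.mk _ τ : MulAction.orbitRel.Quotient X.Gamma ℍ) = y ∧ G τ = P} =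
      Nat.card {y : Y0 M // ∃ τ : ℍ, Y0.mk M τ = y ∧ Ψ τ = P} := by
  -- membership transfer along `hΓ`
  have hmem : ∀ γ : GL (Fin 2) ℝ, γ ∈ X.Gamma ↔ ∃ w : SL(2, ℤ), w ∈ Gamma0 M ∧ mapGL ℝ w = h⁻¹ * γ * h := by
    intro γ
    have e : γ ∈ X.Gamma ↔ h⁻¹ * γ * h ∈ toConjAct h⁻¹ • X.Gamma := by
      rw [mem_conjAct_inv_smul_iff]
      simp only [← mul_assoc, mul_inv_cancel, one_mul, mul_inv_cancel_right]
    rw [e, hΓ, Subgroup.mem_map]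
  -- the map on orbit spaces
  have hcompat : ∀ τ₁ τ₂ : ℍ, MulAction.orbitRel X.Gamma ℍ τ₁ τ₂ →
      MulAction.orbitRel (Gamma0 M) ℍ (h⁻¹ • τ₁) (h⁻¹ • τ₂) := by
    rintro τ₁ τ₂ ⟨⟨γ, hγ⟩, rfl⟩
    obtain ⟨w, hw, hwγ⟩ := (hmem γ).mp hγ
    refine ⟨⟨w, hw⟩, ?_⟩
    change (w : SL(2, ℤ)) • (h⁻¹ • τ₂) = h⁻¹ • ((⟨γ, hγ⟩ : X.Gamma) • τ₂)
    rw [ModularGroup.sl_moeb, show ((w : SL(2, ℤ)) : GL (Fin 2) ℝ) = mapGL ℝ w from rfl, hwγ,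
      Subgroup.mk_smul, smul_smul, smul_smul]
    congr 1
    group
  let ψ : MulAction.orbitRel.Quotient X.Gamma ℍ → Y0 M :=
    Quotient.map' (fun τ : ℍ => h⁻¹ • τ) hcompat
  have hψ_mk : ∀ τ : ℍ, ψ (Quotient.mk _ τ) = Y0.mk M (h⁻¹ • τ) := fun τ => rfl
  have hψ_inj : Function.Injective ψ := by
    intro y₁ y₂
    induction y₁ using Quotient.inductionOn with
    | h τ₁ =>
      induction y₂ using Quotient.inductionOn with
      | h τ₂ =>
        intro heq
        rw [hψ_mk, hψ_mk, Y0.mk_eq_mk_iff] at heq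
        obtain ⟨⟨w, hw⟩, hwτ⟩ := heq
        apply Quotient.sound
        refine ⟨⟨h * mapGL ℝ w * h⁻¹, (hmem _).mpr ⟨w, hw, by group⟩⟩, ?_⟩
        change (h * mapGL ℝ w * h⁻¹) • τ₂ = τ₁
        have hwτ' : (mapGL ℝ w : GL (Fin 2) ℝ) • (h⁻¹ • τ₂) = h⁻¹ • τ₁ := hwτ
        rw [mul_smul, mul_smul, hwτ', smul_smul, mul_inv_cancel, one_smul]
  have hψ_surj : Function.Surjective ψ := by
    intro y
    obtain ⟨τ, rfl⟩ := Y0.mk_surjective M y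
    refine ⟨Quotient.mk _ (h • τ), ?_⟩
    rw [hψ_mk, smul_smul, inv_mul_cancel, one_smul]
  refine Nat.card_congr ((Equiv.ofBijective ψ ⟨hψ_inj, hψ_surj⟩).subtypeEquiv fun y => ?_)
  induction y using Quotient.inductionOn with
  | h τ₁ =>
    rw [Equiv.ofBijective_apply]
    constructor
    · rintro ⟨τ, hτ, hGτ⟩
      refine ⟨h⁻¹ • τ, ?_, by rw [← hG, hGτ]⟩
      rw [← hψ_mk, hτ]
    · rintro ⟨τ', hτ', hΨ⟩
      refine ⟨h • τ', hψ_inj ?_, by rw [hG, smul_smul, inv_mul_cancel, one_smul, hΨ]⟩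
      rw [hψ_mk, smul_smul, inv_mul_cancel, one_smul, hτ']

/-- **Finiteness of the exceptional set transports** along the bijection of
`card_orbitFibre_eq_of_conj`: the exceptional sets `{P | #(orbit-fibre over P) ≠ d}` for `G` on
`Γ₀^1(M)∖ℍ` and for `Ψ` on `Y₀(M)` coincide. [folklore] -/
theorem ShimuraCurveData.finite_setOf_card_orbitFibre_ne_of_conj (X : ShimuraCurveData 1 M)
    {h : GL (Fin 2) ℝ} (hΓ : toConjAct h⁻¹ • X.Gamma = (Gamma0 M).map (mapGL ℝ))
    {A : Type*} (Ψ G : ℍ → A) (hG : ∀ τ, G τ = Ψ (h⁻¹ • τ)) (d : ℕ)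
    (hfin : {P : A | Nat.card {y : Y0 M // ∃ τ : ℍ, Y0.mk M τ = y ∧ Ψ τ = P} ≠ d}.Finite) :
    {P : A | Nat.card {y : MulAction.orbitRel.Quotient X.Gamma ℍ // ∃ τ : ℍ,
        (Quotient.mk _ τ : MulAction.orbitRel.Quotient X.Gamma ℍ) = y ∧ G τ = P} ≠ d}.Finite := by
  convert hfin using 3
  rw [X.card_orbitFibre_eq_of_conj hΓ Ψ G hG]

end Orbits

/-! ### The `D = 1` automorphic half from the newform, and the assembly -/

section Assembly

open Literature.NumberTheory.EllipticCurves.ModularForms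
  (IsNeronLatticeOf IsNewformOf exists_isNewformOf exists_modularDegree_holds Y0 Y0.mk
    IsNewform0.heckeT_eq_coeff_smul IsNewform0.ne_zero cuspCoeff
    IsNewformOf.exists_maninConstant_ne_zero_holds)

/-- **The `D = 1` automorphic half from the newform of `W`.** Let `X` be a Shimura curve datum of
level `(1, M)` (so `B ≃ M₂(ℚ)` and `Γ₀^1(M) = h Γ₀(M) h⁻¹`, `det h > 0`,
`exists_conj_of_discr_one`), `f ∈ S₂(Γ₀(M))` the newform of the elliptic curve `W`
(`IsNewformOf W f`), `L` a Néron-type period pair of `W` and `c ≠ 0` an integer with `c Λ_f ⊆ Λ_L`.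
Then `F = c · 2πi · (f ∣[2] h⁻¹) ∈ S₂(Γ₀^1(M))` has periods in `Λ_L`
(`segmentIntegral_eq_and_hasPeriodsIn_of_conj`), satisfies `T_ℓ F = a_ℓ(W) F` for primes `ℓ ∤ M`
(`heckeFun_eq_mul_of_conj` with `T_ℓ f = a_ℓ(f) f = a_ℓ(W) f`, Diamond–Shurman Prop. 5.8.5), and
`Γ₀^1(M)τ ↦ ∫_{τ₀}^τ F (mod Λ_L)` has the fibre count of the classical map
`Γ₀(M)τ' ↦ c · 2πi∫_{i∞}^{τ'} f (mod Λ_L)` on `Y₀(M)` (tree `exists_modularDegree_holds`), read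
through `τ' = h⁻¹ τ` and translated by the constant `c · 2πi∫_{i∞}^{h⁻¹τ₀} f`. This is the
split case of Pasten's `φ_{D,M} = q ∘ j` (§2 p. 12: for `D = 1` "the Eichler–Shimura construction
gives an optimal quotient `q_{1,N} : J₀(N) → A_{1,N}`"), for an ARBITRARY presentation
`(B, O, ι)` of `X₀(N)`. [cite: PastenShimura2024, §2 p. 12 and §5.3 p. 17] [cite: DiamondShurman2005, Prop. 5.2.1 and Prop. 5.8.5] -/
theorem automorphicHalf_one_of_isNewformOf {M : ℕ} [NeZero M] (X : ShimuraCurveData 1 M)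
    (W : WeierstrassCurve ℚ) {f : CuspForm (Gamma0 M) 2} (hf : IsNewformOf W f)
    {L : PeriodPair} {c : ℤ} (hc0 : c ≠ 0) (hcΛ : ∀ z ∈ periodLattice f, (c : ℂ) * z ∈ L.lattice) :
    ∃ (F : CuspForm X.Gamma 2) (τ₀ : ℍ) (d : ℕ),
      HasPeriodsIn X.Gamma F (L.lattice : Set ℂ) ∧
      (∀ ℓ : ℕ, ℓ.Prime → ¬ ℓ ∣ 1 * M →
        X.heckeFun ℓ F = fun τ => ((W.LFunction ℓ : ℤ) : ℂ) * F τ) ∧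
      0 < d ∧
      {P : ℂ ⧸ L.lattice.toAddSubgroup |
        Nat.card {y : MulAction.orbitRel.Quotient X.Gamma ℍ // ∃ τ : ℍ,
          (Quotient.mk _ τ : MulAction.orbitRel.Quotient X.Gamma ℍ) = y ∧
            ((segmentIntegral F τ₀ τ : ℂ) : ℂ ⧸ L.lattice.toAddSubgroup) = P} ≠ d}.Finite := by
  obtain ⟨-, h, hdet, H⟩ := X.exists_conj_of_discr_one
  have hΓ := X.conjAct_inv_smul_Gamma_eq_of_conj H
  obtain ⟨F, hF⟩ := X.exists_cuspForm_coe_eq_smul_slash hΓ f ((c : ℂ) * (2 * Real.pi * Complex.I))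
  have hcΛ' : ∀ z ∈ periodLattice f, (c : ℂ) * z ∈ L.lattice.toAddSubgroup := fun z hz =>
    (Submodule.mem_toAddSubgroup _).mpr (hcΛ z hz)
  obtain ⟨hseg, hper⟩ := X.segmentIntegral_eq_and_hasPeriodsIn_of_conj hdet hΓ f (c : ℂ) F hF hcΛ'
  obtain ⟨d, hd, hfin⟩ := exists_modularDegree_holds (IsNewform0.ne_zero hf.1) (c := (c : ℂ))
    (by exact_mod_cast hc0) hcΛ
  set τ₀ : ℍ := UpperHalfPlane.I
  set K : ℂ := (c : ℂ) * eichlerIntegral f (h⁻¹ • τ₀) with hK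
  refine ⟨F, τ₀, d, ?_, fun ℓ hℓ hℓM => ?_, hd, ?_⟩
  · simpa only [Submodule.coe_toAddSubgroup] using hper
  · haveI : NeZero ℓ := ⟨hℓ.ne_zero⟩
    have hℓM' : ¬ ℓ ∣ M := by simpa using hℓM
    have hT : (⇑(heckeT (Gamma0 M) 2 ℓ f) : ℍ → ℂ) = ((W.LFunction ℓ : ℤ) : ℂ) • ⇑f := by
      rw [IsNewform0.heckeT_eq_coeff_smul hf.1 hℓ, CuspForm.IsGLPos.coe_smul]
      congr 1
      exact hf.2 ℓ
    exact X.heckeFun_eq_mul_of_conj H hdet hΓ f _ F hF hℓ hℓM' hT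
  · -- the fibre count, transported from `Y₀(M)` and translated by `K`
    set e : ℂ ⧸ L.lattice.toAddSubgroup ≃ ℂ ⧸ L.lattice.toAddSubgroup :=
      Equiv.subRight ((K : ℂ) : ℂ ⧸ L.lattice.toAddSubgroup) with he
    have hfin' := (finite_setOf_card_orbitFibre_ne_iff (Y0.mk M) e
      (fun τ : ℍ => (((c : ℂ) * eichlerIntegral f τ : ℂ) : ℂ ⧸ L.lattice.toAddSubgroup)) d).mpr hfin
    refine X.finite_setOf_card_orbitFibre_ne_of_conj hΓ
      (fun τ : ℍ => e (((c : ℂ) * eichlerIntegral f τ : ℂ) : ℂ ⧸ L.lattice.toAddSubgroup))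
      (fun τ : ℍ => ((segmentIntegral F τ₀ τ : ℂ) : ℂ ⧸ L.lattice.toAddSubgroup))
      (fun τ => ?_) d hfin'
    simp only [he, Equiv.subRight_apply, hseg, hK, QuotientAddGroup.mk_sub]

/-- **The `D = 1` automorphic half of `nonempty_shimuraParametrizationData` follows from the
Modularity theorem alone** (`exists_isNewformOf`, Diamond–Shurman Thm. 8.8.3; BCDT 2001 Thm. A):
the newform `f` of `W` exists at level `N_W = M`, an integer `c ≠ 0` with `c Λ_f ⊆ Λ_L` exists by
Shimura's construction and Faltings' isogeny theorem (the tree's discharged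
`IsNewformOf.exists_maninConstant_ne_zero_holds`), and `automorphicHalf_one_of_isNewformOf`
transports `c · 2πi f(τ) dτ` from `X₀(M)` to the arbitrary presentation `Γ₀^1(M)∖ℍ` of the datum.
[cite: DiamondShurman2005, Thm. 8.8.3] [cite: PastenShimura2024, §2 p. 12] -/
theorem automorphicHalf_one_of_exists_isNewformOf (hmod : exists_isNewformOf) {N M : ℕ}
    (hNDM : IsAdmissibleFactorization N 1 M) (X : ShimuraCurveData 1 M) (W : WeierstrassCurve ℚ)
    [W.IsElliptic] [W.IsGloballyMinimal] (hN : W.conductorNorm ℤ = N) {L : PeriodPair}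
    (hL : IsNeronLatticeOf (W.baseChange ℂ) L) :
    ∃ (F : CuspForm X.Gamma 2) (τ₀ : ℍ) (d : ℕ),
      HasPeriodsIn X.Gamma F (L.lattice : Set ℂ) ∧
      (∀ ℓ : ℕ, ℓ.Prime → ¬ ℓ ∣ 1 * M →
        X.heckeFun ℓ F = fun τ => ((W.LFunction ℓ : ℤ) : ℂ) * F τ) ∧
      0 < d ∧
      {P : ℂ ⧸ L.lattice.toAddSubgroup |
        Nat.card {y : MulAction.orbitRel.Quotient X.Gamma ℍ // ∃ τ : ℍ,
          (Quotient.mk _ τ : MulAction.orbitRel.Quotient X.Gamma ℍ) = y ∧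
            ((segmentIntegral F τ₀ τ : ℂ) : ℂ ⧸ L.lattice.toAddSubgroup) = P} ≠ d}.Finite := by
  have hMN : N = M := by
    have := hNDM.mul_eq
    rw [one_mul] at this
    exact this.symm
  subst hMN
  subst hN
  haveI : NeZero (W.conductorNorm ℤ) := ⟨hNDM.pos.ne'⟩
  obtain ⟨f, hf⟩ := hmod W
  obtain ⟨c, hc0, hcΛ⟩ := IsNewformOf.exists_maninConstant_ne_zero_holds hf hL
  exact automorphicHalf_one_of_isNewformOf X W hf hc0 hcΛ

/-- **`nonempty_shimuraParametrizationData` from the Modularity theorem and, for `D > 1`, a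
Jacquet–Langlands eigenform with Néron periods.** The `D = 1` hypothesis of the tree's
`nonempty_shimuraParametrizationData_of_one_and_eigenform` is now discharged from
`exists_isNewformOf` (`automorphicHalf_one_of_exists_isNewformOf`); what remains for `D > 1` is
exactly `hJL`: for every datum `X` of level `(D, M)`, `1 < D`, every globally minimal elliptic
`W/ℚ` of conductor `D M` and every Néron-type `L`, a NON-ZERO `h ∈ S₂(Γ₀^D(M))` with periods in
`Λ_L` and `T_ℓ h = a_ℓ(W) h` (`ℓ ∤ D M`) — the Jacquet–Langlands transfer of the newform of `W` to
the definite-at-`D` quaternion algebra (Jacquet–Langlands 1970, Thm. 16.1; Pasten §4.10) followed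
by Shimura's construction on `J₀^D(M)` and Faltings' isogeny theorem (Pasten §2 p. 12, §4.11),
none of which is stated in the tree for the groups `ι(O¹)`.
[cite: PastenShimura2024, §2 p. 12 and §4.10–4.11 p. 16 and Prop. 5.1 p. 17]
[cite: DiamondShurman2005, Thm. 8.8.3] [cite: JacquetLanglands1970, Thm. 16.1] -/
theorem nonempty_shimuraParametrizationData_of_exists_isNewformOf (hmod : exists_isNewformOf)
    (hJL : ∀ {N D M : ℕ}, IsAdmissibleFactorization N D M → 1 < D →
      ∀ (X : ShimuraCurveData D M) (W : WeierstrassCurve ℚ) [W.IsElliptic] [W.IsGloballyMinimal],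
        W.conductorNorm ℤ = N → ∀ {L : PeriodPair}, IsNeronLatticeOf (W.baseChange ℂ) L →
        ∃ h : CuspForm X.Gamma 2, (⇑h : ℍ → ℂ) ≠ 0 ∧
          HasPeriodsIn X.Gamma h (L.lattice : Set ℂ) ∧
          ∀ ℓ : ℕ, ℓ.Prime → ¬ ℓ ∣ D * M →
            X.heckeFun ℓ h = fun τ => ((W.LFunction ℓ : ℤ) : ℂ) * h τ) :
    nonempty_shimuraParametrizationData :=
  nonempty_shimuraParametrizationData_of_one_and_eigenform
    (fun hNDM X W _ _ hN _ hL => automorphicHalf_one_of_exists_isNewformOf hmod hNDM X W hN hL) hJL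

end Assembly



end Literature.NumberTheory.Automorphic

end
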